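import Literature.MathematicalPhysics.QuantumFieldTheory.Balaban1983to89.B8Prop6DentedCubeMemberGaugedRealGammaRec
import Literature.MathematicalPhysics.QuantumFieldTheory.Balaban1983to89.B8Ineq159Flat4OfScalarBdryBetaRec
import Literature.MathematicalPhysics.QuantumFieldTheory.Balaban1983to89.B8Prop6DentedCubeMemberScalarGamma

/-!
# `Balaban1983to89.B8Prop6DentedCubeMemberScalarGammaRec` — RECORD TWIN of `B8Prop6DentedCubeMemberScalarGamma` ([Balaban1985RegularSpaces] Prop. 6 (1.135)–(1.138) p. 99 AS
# `Node00.GaugedBoundB8DZ` at every dented RECORD member from the SCALAR flat γ clauses and the three REAL families — NO gauge-field hypothesis) FOR THE SYMMETRISED CENTRED block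
# averaging (0.4) of [Balaban1987RG1] — item R6 (g)-6 of the record crown (desk `R6-PLAN.md` §5)

statement-level skeleton of published theorems with citation tags; proofs where landed; nothing here is a claim about the Yang–Mills mass gap

T. Bałaban, *Spaces of regular gauge field configurations on a lattice and gauge fixing conditions*, Commun. Math. Phys. **99** (1985) 75–102
`[Balaban1985RegularSpaces]` ("[6]"): Prop. 6 (1.135)–(1.138) p. 99, Thm 4 p. 88, Prop. 3 p. 87, Prop. 5 p. 93, (1.58)–(1.59) p. 86, (1.31) p. 82; T. Bałaban, *Propagators for lattice gauge
theories in a background field*, Commun. Math. Phys. **99** (1985) 389–434 `[Balaban1985BackgroundPropagators]` ("[4]"): Thms 3.1–3.3 pp. 397–399, p. 394 («⊗ identity»); T. Bałaban,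
*Renormalization group approach to lattice gauge field theories. I*, Commun. Math. Phys. **109** (1987) 249–301 `[Balaban1987RG1]` ("[I]"): (0.3)–(0.4) pp. 252–253.  STATUS: published, refereed.

CITATION HEADER (lean-in-tree rule).  Cell `pub-ymgap`, «N05-REC» stage 2 (director-ym №254∕№255∕№288), item R6 (g)-6 — typed by the LEAD PEN dag-n05-e g39 (inventory `N05-REC-INVENTORY.md` §R6 row
`B8Prop6DentedCubeMemberScalarGamma`: A `gaugedBoundB8D_dentedMember_scalar_γ`).  WHAT IS REPRODUCED = ✓ the engine module (seat `pub-ymgap-dag-n05-e` g31∕g32) VERBATIM under the token map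
of (g)-4∕(g)-5 (`Real123Block L (flmZ L)` REAL premise, record (1.61) constant, `IsLandau138Z ∕ linCovIterZ` scalar clauses).  THEOREM NAME = the engine's (namespace `…ScalarGammaRec`).  Record inputs: (g)-5
`B8Prop6DentedCubeMemberGaugedRealGammaRec.gaugedBoundB8D_dentedMember_real_γ`, g38's R6-9∕R6-10 `B8Ineq159FlatOfScalarBdryBetaRec.flat159Z_clause_of_scalar_bdryβ` ∕
`B8Ineq159Flat4OfScalarBdryBetaRec.flat159Z_clause4_of_scalar_bdryβ`; structure-free `B8Prop6OfThm4.smallness_134`.  Kind «kernel-checked proof», theorems only; no `def`, no `instance`, no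
`notation`, no existing module modified.  `--supports stmt-QuantumFields-20541` (K0⁷-keyed, COUNT-NEUTRAL).

HONEST SCOPE: the engine's proof verbatim under the token map; nothing of Bałaban's analysis newly proved; the scalar clauses and the REAL families stay displayed (discharged in the next file by
g38's unconditional Z facts); `HThm4Rec` UNDISCHARGED; caveat (C-S3-1) + addendum v4 stand; N05 [B8] DISCHARGED OF RECORD untouched; N05 ∕ N07 NOT discharged; COUNT of record unmoved · K
numerically unchanged; one finite `𝕋⁴` programme at fixed `ε`, Bałaban AS PRINTED; nothing continuum ∕ ℝ⁴ ∕ OS ∕ mass-gap ∕ Clay.  No `sorry`, no `def`.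

[cite: Balaban1985RegularSpaces, Prop. 6 (1.135)–(1.138) p.99, Theorem 4 p.88, Prop. 3 p.87, Prop. 5 p.93, (1.58)–(1.59) p.86, (1.31) p.82; Balaban1985BackgroundPropagators, Theorems 3.1–3.3
pp.397–399, p.394; Balaban1987RG1, (0.3)–(0.4) pp.252–253]
-/

noncomputable section

open NormedSpace
open scoped BigOperators

namespace Literature.MathematicalPhysics.QuantumFieldTheory.Balaban1983to89.B8Prop6DentedCubeMemberScalarGammaRec

open scoped Matrix
open MatrixLog B7Prop1Explicit B7Prop2Explicit B7Prop1Local B7Eq92Concrete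
open B7Prop2Explicit (c2' c2'_pos)
open B7Prop2Rec (C0Z C0Z_pos)
open B7Prop3Flat (c3)
open B7Prop4GeneralLevelsRec (cZ gZ KZ gZ_nonneg)
open B7SectEFLinearisationRec (linCovIterZ)
open B8Ineq132 (covDerivFwd InAk BondTouches)
open B8Ineq133Rec (cutFixedZ)
open B8Eq115GaugeFixingRec (localGaugeZ)
open B8Lemma1NonAbelian (mulCfg)
open B8Eq119TwistedAxialRec (Restr129Z flmZ)
open B8Eq140Level (SideTouches)
open B8Eq143PlaqExpansion (pdiv)
open B8Eq146AExpansion (iEta plaqCovDeriv)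
open B8Eq155JBound (Jcur wsup)
open B8ScaledSupNorm (bondNorm msup)
open B8Eq184Proof (cfgExp)
open B8Eq138LandauZd (covLap logCfg)
open B8Eq138LandauZdRec (IsLandau138WZ IsLandau138Z)
open B8LambdaSpaceKLevel (wt)
open B8Eq131Cubes (tLo tHi ctr)
open B8Ineq130Rec (tlo thi)
open B8Prop6OfThm4 (const_136 smallness_134)
open B8Prop6DentedCubeMemberGaugedRealGammaRec (gaugedBoundB8D_dentedMember_real_γ)
open B8Ineq159FlatOfScalarBdryBetaRec (flat159Z_clause_of_scalar_bdryβ)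
open B8Ineq159Flat4OfScalarBdryBetaRec (flat159Z_clause4_of_scalar_bdryβ)
open B9SupplySockB9P3ZdBeta (CrossB)
open Node00 (CubeB8DZ GaugedBoundB8DZ)
open B8Real123FlatTranslateRec (Real123Block)

export B7Prop1Explicit (Site)

variable {d : ℕ}

variable {𝔸 : Type} [CStarAlgebra 𝔸] [Nontrivial 𝔸]

/-! ## §1 `GaugedBoundB8` at every cube from scalar clauses + real families -/

open Classical in
/-- ★★ **PROPOSITION 6 (p. 99), (1.135)–(1.138) AS `Node00.GaugedBoundB8` AT EVERY CUBE, FROM THE SCALAR FLAT γ CLAUSES AND THE THREE REAL INEQUALITY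
FAMILIES — NO GAUGE-FIELD HYPOTHESIS** — p534762's `gaugedBoundB8_cubeMember_scalar_bdry` in EDITION γ: `gaugedBoundB8D_dentedMember_real_γ` with its flat
four-line flat socket SERVED by `flat159_clause4_of_scalar_bdryβ` from the SCALAR four-line γ clause at the top truncation, and its `H59Dβ₁` SERVED by
`flat159_clause_of_scalar_bdryβ` from the SCALAR two-line γ clause at every truncation; thresholds as in p534762.
[cite: Balaban1985RegularSpaces, Prop. 6 (1.135)–(1.138) p.99, Thm 4 p.88, Prop. 3 p.87, Prop. 5 p.93, (1.58)–(1.59) p.86, (1.31) p.82; Balaban1985BackgroundPropagators, Thms 3.1–3.3 pp.397–399, p.394 («⊗ identity»)] -/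
theorem gaugedBoundB8D_dentedMember_scalar_γ (hd2 : 2 ≤ d) {L sL : ℕ} (hLs : L = 2 * sL + 1) (hs1 : 1 ≤ sL) {B₀ B₀' C₂ B₀'H B₂' BG BR Bbd : ℝ} (hB₀ : 0 < B₀)
    (hB₀' : 0 < B₀') (hB : 2 ≤ 5 * (d : ℝ) * L * B₀) (hC₂ : 2 * ((1 + 2 * gZ d L) * (2 * (131072 * ((d : ℝ) + 1) ^ 2) * (KZ d L) ^ 2)) * (L : ℝ) ^ 2 ≤ C₂)
    (hB₀'H : 0 < B₀'H) (hB₂' : 0 ≤ B₂') (hBG : 0 ≤ BG) (hBR : 0 ≤ BR) (hfree : 3 * (2 * (d : ℝ) * (L : ℝ) ^ 2) * BG * BR ≤ B₀')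
    (hBbd : 0 ≤ Bbd) (hBd : 4 * Bbd ≤ ((d : ℝ) * L - 1) * B₀) :
    ∃ c₁ : ℝ, 0 < c₁ ∧ ∀ (η : ℝ), 0 < η → ∀ {K : ℕ} {Ω : ℕ → Set (Site d)} (c : CubeB8DZ d L K Ω),
      -- THE SCALAR FLAT FOUR-LINE (1.59) CLAUSE OF PROPOSITION 3's FRAME at the cube's top truncation `c.k`: ℂ-valued bond functions in the
      -- flat Landau gauge on the collars of `{□_j}`, exterior-collar allowance on each line ([4] Thm 3.3 at `U = 1` for `G(1)`, `H(1)`, a priori)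
      (∀ φ : Site d → Fin d → ℂ,
        IsLandau138Z L c.k η (c.sq 0) c.lamS (1 : Site d → Fin d → ℂˣ) φ →
        (∀ (y : Site d) (τ : Fin d), (∀ j, j ≤ c.k → ¬ SideTouches (c.sq j) y τ) → φ y τ = 0) →
        msup L c.k η (-(1 : ℝ)) (fun j (b : Site d × Fin d) => SideTouches (c.sq j) b.1 b.2) (fun b => φ b.1 b.2)
          ≤ B₀ * (bondNorm L c.k η (-(3 : ℝ)) c.sq (fun x μ => Jcur η (1 : Site d → Fin d → ℂˣ) φ μ x)
            + wsup 1 (fun p : {p : ℕ × (Site d × Fin d) // p.1 ≤ c.k ∧ (p.2 ∈ c.lamBPT c.k p.1 ∨ (p.1 = 0 ∧ CrossB (c.sq 0) p.2))} =>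
                linCovIterZ L (1 : Site d → Fin d → ℂˣ) (iEta η φ) p.1.1 p.1.2.1 p.1.2.2))
            + Bbd * msup L c.k η (-(1 : ℝ)) (fun j (b : Site d × Fin d) => j = 0 ∧ SideTouches (c.sq 0) b.1 b.2 ∧
                ¬ BondTouches (c.sq 0) b.1 b.2) (fun b => φ b.1 b.2) ∧
        msup L c.k η (-(2 : ℝ)) (fun j (t : Fin d × Fin d × Site d) => SideTouches (c.sq j) t.2.2 t.2.1)
            (fun t => covDerivFwd η (1 : Site d → Fin d → ℂˣ) t.1 (fun z => φ z t.2.1) t.2.2)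
          ≤ B₀ * (bondNorm L c.k η (-(3 : ℝ)) c.sq (fun x μ => Jcur η (1 : Site d → Fin d → ℂˣ) φ μ x)
            + wsup 1 (fun p : {p : ℕ × (Site d × Fin d) // p.1 ≤ c.k ∧ (p.2 ∈ c.lamBPT c.k p.1 ∨ (p.1 = 0 ∧ CrossB (c.sq 0) p.2))} =>
                linCovIterZ L (1 : Site d → Fin d → ℂˣ) (iEta η φ) p.1.1 p.1.2.1 p.1.2.2))
            + Bbd * msup L c.k η (-(1 : ℝ)) (fun j (b : Site d × Fin d) => j = 0 ∧ SideTouches (c.sq 0) b.1 b.2 ∧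
                ¬ BondTouches (c.sq 0) b.1 b.2) (fun b => φ b.1 b.2) ∧
        bondNorm L c.k η (-(3 : ℝ)) c.sq (fun x μ => pdiv η (1 : Site d → Fin d → ℂˣ) (plaqCovDeriv η (1 : Site d → Fin d → ℂˣ) φ) μ x)
          ≤ B₀ * (bondNorm L c.k η (-(3 : ℝ)) c.sq (fun x μ => Jcur η (1 : Site d → Fin d → ℂˣ) φ μ x)
            + wsup 1 (fun p : {p : ℕ × (Site d × Fin d) // p.1 ≤ c.k ∧ (p.2 ∈ c.lamBPT c.k p.1 ∨ (p.1 = 0 ∧ CrossB (c.sq 0) p.2))} =>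
                linCovIterZ L (1 : Site d → Fin d → ℂˣ) (iEta η φ) p.1.1 p.1.2.1 p.1.2.2))
            + Bbd * msup L c.k η (-(1 : ℝ)) (fun j (b : Site d × Fin d) => j = 0 ∧ SideTouches (c.sq 0) b.1 b.2 ∧
                ¬ BondTouches (c.sq 0) b.1 b.2) (fun b => φ b.1 b.2) ∧
        bondNorm L c.k η (-(3 : ℝ)) c.sq (fun x μ => covLap η (1 : Site d → Fin d → ℂˣ) (fun z => φ z μ) x)
          ≤ B₀ * (bondNorm L c.k η (-(3 : ℝ)) c.sq (fun x μ => Jcur η (1 : Site d → Fin d → ℂˣ) φ μ x)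
            + wsup 1 (fun p : {p : ℕ × (Site d × Fin d) // p.1 ≤ c.k ∧ (p.2 ∈ c.lamBPT c.k p.1 ∨ (p.1 = 0 ∧ CrossB (c.sq 0) p.2))} =>
                linCovIterZ L (1 : Site d → Fin d → ℂˣ) (iEta η φ) p.1.1 p.1.2.1 p.1.2.2))
            + Bbd * msup L c.k η (-(1 : ℝ)) (fun j (b : Site d × Fin d) => j = 0 ∧ SideTouches (c.sq 0) b.1 b.2 ∧
                ¬ BondTouches (c.sq 0) b.1 b.2) (fun b => φ b.1 b.2)) →
      ∀ (U₀ : Site d → Fin d → 𝔸ˣ), (∀ x κ, U₀ x κ ∈ unitaryUnits 𝔸) → ∀ (α₀ : ℝ), 0 < α₀ → InAk L K η α₀ Ω U₀ →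
      7 * d * (L : ℝ) ^ 2 * c.M * α₀ ≤ c₁ →
      -- the weights of `Q′ᵀwQ′` and THE THREE REAL INEQUALITY FAMILIES at every truncation `n ≤ k`, CENTRED labels (`Real123Block`)
      ∀ (w : ℕ → ℝ), (∀ j, 0 ≤ w j) →
      (∀ n, 1 ≤ n → n ≤ c.k → Real123Block L (flmZ L) η n w c.sq (c.lamST n) BG B₀'H B₂' BR) →
      -- THE SCALAR FLAT TWO-LINE (1.59) CLAUSE OF THEOREM 4's FRAME at every truncation `m ≤ c.k` (ℂ-valued, flat Landau gauge, collar allowance)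
      (∀ m, 1 ≤ m → m ≤ c.k → ∀ φ : Site d → Fin d → ℂ,
        IsLandau138Z L m η (c.sq 0) (c.lamST m) (1 : Site d → Fin d → ℂˣ) φ →
        (∀ (y : Site d) (τ : Fin d), (∀ j, j ≤ m → ¬ SideTouches (c.sq j) y τ) → φ y τ = 0) →
        msup L m η (-(1 : ℝ)) (fun j (b : Site d × Fin d) => SideTouches (c.sq j) b.1 b.2) (fun b => φ b.1 b.2)
          ≤ B₀ * (bondNorm L m η (-(3 : ℝ)) c.sq (fun x μ => Jcur η (1 : Site d → Fin d → ℂˣ) φ μ x)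
            + wsup 1 (fun p : {p : ℕ × (Site d × Fin d) // p.1 ≤ m ∧ (p.2 ∈ c.lamBPT m p.1 ∨ (p.1 = 0 ∧ CrossB (c.sq 0) p.2))} =>
                linCovIterZ L (1 : Site d → Fin d → ℂˣ) (iEta η φ) p.1.1 p.1.2.1 p.1.2.2))
            + Bbd * msup L m η (-(1 : ℝ)) (fun j (b : Site d × Fin d) => j = 0 ∧ SideTouches (c.sq 0) b.1 b.2 ∧
                ¬ BondTouches (c.sq 0) b.1 b.2) (fun b => φ b.1 b.2) ∧
        msup L m η (-(2 : ℝ)) (fun j (t : Fin d × Fin d × Site d) => SideTouches (c.sq j) t.2.2 t.2.1)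
            (fun t => covDerivFwd η (1 : Site d → Fin d → ℂˣ) t.1 (fun z => φ z t.2.1) t.2.2)
          ≤ B₀ * (bondNorm L m η (-(3 : ℝ)) c.sq (fun x μ => Jcur η (1 : Site d → Fin d → ℂˣ) φ μ x)
            + wsup 1 (fun p : {p : ℕ × (Site d × Fin d) // p.1 ≤ m ∧ (p.2 ∈ c.lamBPT m p.1 ∨ (p.1 = 0 ∧ CrossB (c.sq 0) p.2))} =>
                linCovIterZ L (1 : Site d → Fin d → ℂˣ) (iEta η φ) p.1.1 p.1.2.1 p.1.2.2))
            + Bbd * msup L m η (-(1 : ℝ)) (fun j (b : Site d × Fin d) => j = 0 ∧ SideTouches (c.sq 0) b.1 b.2 ∧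
                ¬ BondTouches (c.sq 0) b.1 b.2) (fun b => φ b.1 b.2)) →
      GaugedBoundB8DZ L η U₀ c (7 * d * (L : ℝ) ^ 2 * (5 * (d : ℝ) * L * B₀) * c.M * α₀) := by
  have hL1 : 1 ≤ L := by omega
  have hLpos : (0 : ℝ) < L := by exact_mod_cast hL1
  have hdpos : (0 : ℝ) < d := by exact_mod_cast (lt_of_lt_of_le (by norm_num) hd2 : 0 < d)
  obtain ⟨c₁, hc₁, G⟩ := gaugedBoundB8D_dentedMember_real_γ (𝔸 := 𝔸) hd2 hLs hs1 hB₀ hB₀' hB hC₂ (cB9 := 1 / 2) (by norm_num) hB₀'H hB₂' hBG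
    hBR hfree hBbd hBd
  -- the allowance of the step datum's exponents is `Kc·(L³α₀ + 6dL²Mα₀) ≤ Kc·7dL²Mα₀`; below `1/(2Kc)` it is `≤ 1/2`, as the `⊗ id` transfer wants
  set Kc : ℝ := 2 * (L * (5 * (d : ℝ) * L * B₀)) + 8 * (8 * B₀' * (5 * (d : ℝ) * L * B₀)) with hKc_def
  have hKc : 0 < Kc := by positivity
  refine ⟨min c₁ (1 / (2 * Kc)), lt_min hc₁ (by positivity), ?_⟩
  intro η hη K Ω c SC4 U₀ hU₀ α₀ hα hAK hs w hw REAL SC2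
  have hLdM : (L : ℝ) ≤ d * c.M := by exact_mod_cast c.L_le_dM
  have hs1 : 7 * d * (L : ℝ) ^ 2 * c.M * α₀ ≤ c₁ := hs.trans (min_le_left _ _)
  have hsK : (L : ℝ) ^ 3 * α₀ + 6 * d * (L : ℝ) ^ 2 * c.M * α₀ ≤ 1 / (2 * Kc) :=
    (smallness_134 hLpos hα hLdM hs).trans (min_le_right _ _)
  have hcoef : 2 * (L * (5 * (d : ℝ) * L * B₀ * (((L : ℝ) ^ 3 * α₀) + (6 * d * (L : ℝ) ^ 2 * c.M * α₀)))) +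
      8 * (8 * B₀' * (5 * (d : ℝ) * L * B₀) * (((L : ℝ) ^ 3 * α₀) + (6 * d * (L : ℝ) ^ 2 * c.M * α₀))) =
      Kc * ((L : ℝ) ^ 3 * α₀ + 6 * d * (L : ℝ) ^ 2 * c.M * α₀) := by rw [hKc_def]; ring
  have hc0 : 0 ≤ 2 * (L * (5 * (d : ℝ) * L * B₀ * (((L : ℝ) ^ 3 * α₀) + (6 * d * (L : ℝ) ^ 2 * c.M * α₀)))) +
      8 * (8 * B₀' * (5 * (d : ℝ) * L * B₀) * (((L : ℝ) ^ 3 * α₀) + (6 * d * (L : ℝ) ^ 2 * c.M * α₀))) := by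
    rw [hcoef]; positivity
  have hchalf : 2 * (L * (5 * (d : ℝ) * L * B₀ * (((L : ℝ) ^ 3 * α₀) + (6 * d * (L : ℝ) ^ 2 * c.M * α₀)))) +
      8 * (8 * B₀' * (5 * (d : ℝ) * L * B₀) * (((L : ℝ) ^ 3 * α₀) + (6 * d * (L : ℝ) ^ 2 * c.M * α₀))) ≤ 1 / 2 := by
    rw [hcoef]
    calc Kc * ((L : ℝ) ^ 3 * α₀ + 6 * d * (L : ℝ) ^ 2 * c.M * α₀) ≤ Kc * (1 / (2 * Kc)) := mul_le_mul_of_nonneg_left hsK hKc.le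
      _ = 1 / 2 := by field_simp
  refine G η hη c ?_ U₀ hU₀ α₀ hα hAK hs1 w hw REAL ?_
  · -- the flat four-line socket at the cube from the scalar four-line clause (`⊗ id`, this seat's `flat159_clause4_of_scalar_bdryβ`)
    intro α₀' α₂ _ _ hα₂ hα₂c W _ _ _ hLan A' _ hWA hA0
    exact flat159Z_clause4_of_scalar_bdryβ hd2 hLs hη c.k c.sq c.lamS
      (c.lamBPT c.k) hB₀.le hBbd hα₂.le hα₂c SC4 W A' hLan hWA hA0
  · -- `H59Dβ₁` from the scalar two-line γ clause at every truncation (this seat's `flat159_clause_of_scalar_bdryβ`)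
    intro m hm1 hmk u W A' hu huS hW h129 hLan hsa hWA hA0
    exact flat159Z_clause_of_scalar_bdryβ hd2 hLs hη m c.sq (c.lamST m)
      (c.lamBPT m) hB₀.le hBbd hc0 hchalf (SC2 m hm1 hmk) W A' hLan hWA hA0

end Literature.MathematicalPhysics.QuantumFieldTheory.Balaban1983to89.B8Prop6DentedCubeMemberScalarGammaRec

end
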